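import Literature.Computability.AlgebraicComplexity.MoreAsymmetricParameters
import Literature.Computability.AlgebraicComplexity.MoreAsymmetricCompatProduct
import Literature.Computability.AlgebraicComplexity.GlobalStageExponent
import HarnessLib

/-!
# The exponent of the one-region more asymmetric global stage:
`log₂ #copies ≥ n · min{H(α_X) − P_α, H(β̄_Y) − η_Y, H(β̄_Z) − λ_Z} − (explicit lower-order terms)`
(Alman–Duan–Vassilevska Williams–Xu–Xu–Zhou 2025, Prop. 5.1 / §5.6: "the above algorithm degenerates
`(CW_q^{⊗2^{ℓ−1}})^{⊗A₁n}` into `numalpha · M₀^{-1-o(1)} ≥ 2^{A₁n · min{H(α_X) − P_α, H(β̄_Y) − η_Y, H(β̄_Z) − λ_Z} − o(n)}`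
independent copies of a level-`ℓ` interface tensor `𝒯*`") — proved

Topic `Literature/Computability/AlgebraicComplexity`.  This file turns the exact one-region count of
`MoreAsymmetricParameters.lean` (`⌊|B| |𝒯α| / (2M²r)⌋` copies, `M₀ < M ≤ 2M₀`, `|B| ≥ (M/2)e^{-4√log M}`)
into the printed exponent, at FIXED `n` and with every lower-order term explicit (no `o(n)`) — the twin
of `GlobalStageExponent.lean` (VXXZ Prop. 5.1), whose entropy estimates of `numalpha`, `|𝒯|`,
`|X-blocks|` are reused: with `Q` the joint type of `𝒯α`, `μ_X` the `X`-marginal type, `θ_Y`, `θ_Z` the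
joint types of the typical `Y`- and `Z`-pairs and `k^Y_S`, `k^Z_S` the integral class types of the
classes of Claim 5.18 (`Y`) and of VXXZ Def. 5.15 (`Z`) (so `C_Y = ∏_S binom(|S|; k^Y_S)`,
`C_Z = ∏_S binom(|S|; k^Z_S)`),

* `MoreAsym.modulusBound_le` — `M₀ ≤ max{16|𝒯|/|X-blocks|, 160 N V_Y, 160 N V_Z, 2c+2}` (reals);
* `logb_card_compatTriplesY_le` — `log₂ V_Y ≤ log₂ A + Λ_Y − n H(θ_Y/n) + |A_pair| log₂(n+1)`
  (`Λ_Y = ∑_S |S| H(k^Y_S/|S|) = n η_Y`, via the double count `V_Y · binom(n; θ_Y) = A · C_Y` of Claim 5.17);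
* `exponent_combine₃` — the bookkeeping with the four branches of `M₀`;
* `advxxz2025_prop51_region_logb` — **the assembled bound**:
  `log₂(#copies + 1) ≥ n · min{H(μ_X/n) − P, H(θ_Y/n) − Λ_Y/n, H(θ_Z/n) − Λ_Z/n, H(Q/n)} − Err`, where
  `P = maxEnt_{levelSupport}(Q/n) − H(Q/n)` is the penalty `P_α` at the type `Q/n`, and
  `Err = (2|S₃| + 2c + 1 + |A_pair|) log₂(n+1) + log₂(160N) + log₂(2c+2) + log₂ r + 4√(log 2M₀)/log 2 + 7`
  — the printed `min{H(α_X) − P_α, H(β̄_Y) − η_Y, H(β̄_Z) − λ_Z}` (`θ_Y` is the joint type of the typical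
  pair `(J, Ĵ)`, a word over pairs (level, chunk shape); since the level of a chunk is determined by its
  shape, `H(θ_Y/n)` is the entropy `H(β̄_{Y,*,*,*})` of the average split distribution for split
  distributions supported on shapes of the right level — Claim 5.17: the number of typical pairs is
  `2^{H(β̄_{Y,*,*,*}) n ± o(n)}`; likewise `H(θ_Z/n) = H(β̄_Z)`; the fourth term `H(Q/n)` records the
  branch `M₀ = 2c+2` and is dominated by the first).

Everything is proved; no definitions; no named facts.  Letting `n → ∞` along types (`ε`-interface tensors,
Thm. 5.3) and the six regions are not part of this file.

## References

* J. Alman, R. Duan, V. Vassilevska Williams, Y. Xu, Z. Xu, R. Zhou, *More asymmetry yields faster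
  matrix multiplication*, SODA 2025, arXiv:2404.16349 (held: `paper:arxiv-2404.16349`, chunks
  p0016, p0019–p0020): Prop. 5.1, Claim 5.4, Claim 5.17, Claim 5.19, eq. (M₀ final), §5.6 (Summary).
  [AlmanDuanVassilevskaWilliamsXuXuZhou2025]
* V. Vassilevska Williams, Y. Xu, Z. Xu, R. Zhou, *New bounds for matrix multiplication: from alpha
  to omega*, SODA 2024, arXiv:2307.07970, Prop. 5.1 and §5.7 (the original exponent).
  [VassilevskaWilliamsXuXuZhou2024]
-/

noncomputable section

open scoped BigOperators
open Finset

namespace Literature.Computability.AlgebraicComplexity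

open Literature.Barriers.MatrixMultiplication (bigCwTensor)

/-- The bookkeeping behind the exponent of the more asymmetric region: abstract real form (four branches
of `M₀`: cleanup in `X`, `Y`-holes, `Z`-holes, `2c+2`). [folklore] -/
theorem exponent_combine₃ {n HQ mE HX HθY HθZ ΛY ΛZ ℓ s₃ sp cX lA lT lX lVY lVZ lM₀ l160 l2c : ℝ}
    (hn : 0 < n) (hℓ : 0 ≤ ℓ) (hs₃ : 0 ≤ s₃) (hsp : 0 ≤ sp) (hcX : 0 ≤ cX) (h160 : 0 ≤ l160) (h2c : 0 ≤ l2c)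
    (eA : n * HQ - s₃ * ℓ ≤ lA) (eT : lT ≤ s₃ * ℓ + n * mE) (eX : n * HX - cX * ℓ ≤ lX)
    (hM₀ : lM₀ ≤ 4 + lT - lX ∨ (lM₀ ≤ l160 + lVY ∧ lVY ≤ lA + ΛY - n * HθY + sp * ℓ) ∨
      (lM₀ ≤ l160 + lVZ ∧ lVZ ≤ lA + ΛZ - n * HθZ + sp * ℓ) ∨ lM₀ ≤ l2c) :
    n * min (min (HX - (mE - HQ)) (HθY - ΛY / n)) (min (HθZ - ΛZ / n) HQ) -
        ((2 * s₃ + cX + sp) * ℓ + l160 + l2c + 4) ≤ lA - lM₀ := by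
  set m := min (min (HX - (mE - HQ)) (HθY - ΛY / n)) (min (HθZ - ΛZ / n) HQ) with hm
  have hmin1 : m ≤ HX - (mE - HQ) := (min_le_left _ _).trans (min_le_left _ _)
  have hmin2 : m ≤ HθY - ΛY / n := (min_le_left _ _).trans (min_le_right _ _)
  have hmin3 : m ≤ HθZ - ΛZ / n := (min_le_right _ _).trans (min_le_left _ _)
  have hmin4 : m ≤ HQ := (min_le_right _ _).trans (min_le_right _ _)
  have p1 := mul_le_mul_of_nonneg_left hmin1 hn.le
  have p2 := mul_le_mul_of_nonneg_left hmin2 hn.le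
  have p3 := mul_le_mul_of_nonneg_left hmin3 hn.le
  have p4 := mul_le_mul_of_nonneg_left hmin4 hn.le
  have e2 : n * (HθY - ΛY / n) = n * HθY - ΛY := by field_simp
  have e3 : n * (HθZ - ΛZ / n) = n * HθZ - ΛZ := by field_simp
  rw [e2] at p2
  rw [e3] at p3
  have hsl : 0 ≤ s₃ * ℓ := mul_nonneg hs₃ hℓ
  have hspl : 0 ≤ sp * ℓ := mul_nonneg hsp hℓ
  have hcl : 0 ≤ cX * ℓ := mul_nonneg hcX hℓ
  rcases hM₀ with h1 | ⟨h2, hVY⟩ | ⟨h3, hVZ⟩ | h4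
  · nlinarith [p1, h1, eA, eT, eX, hsl, hspl, hcl]
  · nlinarith [p2, h2, hVY, eA, hsl, hspl, hcl]
  · nlinarith [p3, h3, hVZ, eA, hsl, hspl, hcl]
  · nlinarith [p4, h4, eA, hsl, hspl, hcl]

namespace GlobalStageData

open scoped Classical

universe u

variable {c n M : ℕ} {D : GlobalStageData c n M}

/-- **`M₀ ≤ max{16|𝒯|/|typeClass μX|, 160 N V_Y, 160 N V_Z, 2c+2}`** (reals), when the `X`-type class is
non-empty. [cite: AlmanDuanVassilevskaWilliamsXuXuZhou2025, §5.5 eq. (M₀ final)] -/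
theorem MoreAsym.modulusBound_le (pY pZ : (Fin n → Fin (2 * c + 1)) × (Fin n → Fin c → Fin 3))
    (hX : 0 < (typeClass n D.μX).card) :
    (MoreAsym.modulusBound D pY pZ : ℝ) ≤
      max (max (16 * (D.tripleSet.card : ℝ) / (typeClass n D.μX).card) (160 * (c * n) * ((D.compatTriplesY pY.1 pY.2).card : ℝ)))
        (max (160 * (c * n) * ((D.compatTriples pZ.1 pZ.2).card : ℝ)) (2 * c + 2)) := by
  unfold MoreAsym.modulusBound
  push_cast [Nat.cast_max]
  have h1 := natDiv_succ_le_max D.tripleSet.card _ hX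
  push_cast at h1
  have h22 : (2 : ℝ) ≤ 2 * c + 2 := by
    have : (0 : ℝ) ≤ c := Nat.cast_nonneg c
    linarith
  refine max_le (max_le ?_ ?_) (max_le ?_ ?_)
  · rcases le_max_iff.1 h1 with h | h
    · exact le_trans h (le_max_of_le_left (le_max_left _ _))
    · exact le_trans h (le_max_of_le_right (le_trans h22 (le_max_right _ _)))
  · exact le_max_of_le_left (le_max_right _ _)
  · exact le_max_of_le_right (le_max_left _ _)
  · exact le_max_of_le_right (le_max_right _ _)

/-- **`log₂ V_Y ≤ log₂ numalpha + Λ_Y − n H(θ_Y/n) + |A_pair| log₂(n+1)`** for `V_Y ≥ 1`: the double count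
`V_Y · binom(n; θ_Y) = numalpha · C_Y` (Claim 5.17), `C_Y ≤ 2^{Λ_Y}` (the product form,
`Λ_Y = ∑_S |S| H(k_S/|S|)`) and `binom(n; θ_Y) ≥ 2^{n H(θ_Y/n)} / (n+1)^{|A_pair|}` — the printed
`p_compY = Q/P = 2^{(η_Y − H(β̄_{Y,*,*,*}) + H(α_Y)) A₁ n ± o(n)}`. [cite: AlmanDuanVassilevskaWilliamsXuXuZhou2025, Claim 5.17] -/
theorem logb_card_compatTriplesY_le (hD : D.WellFormed) (hS : D.Symmetric)
    {T₀ : (Fin n → Fin (2 * c + 1)) × (Fin n → Fin (2 * c + 1)) × (Fin n → Fin (2 * c + 1))} (hT₀ : T₀ ∈ D.𝒯α)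
    {pY : (Fin n → Fin (2 * c + 1)) × (Fin n → Fin c → Fin 3)} (hpY : pY ∈ D.typicalPairsY)
    (kY : Fin (coarseYClasses c).card → (Fin c → Fin 3) → ℕ)
    (hk : ∀ s σ, (kY s σ : ℝ) = (termFibre (coarseYTermMap (isLevelTriple_of_mem_tripleSet (hD.subset hT₀))) s).card *
      (coarseYTermList c D.α D.γY s).γX σ)
    (hsupp : ∀ s σ, kY s σ ≠ 0 → patternLevel σ = (coarseYTermList c D.α D.γY s).i)
    (hsum : ∀ s, ∑ σ, kY s σ = (termFibre (coarseYTermMap (isLevelTriple_of_mem_tripleSet (hD.subset hT₀))) s).card)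
    (hV : 0 < (D.compatTriplesY pY.1 pY.2).card) :
    Real.logb 2 ((D.compatTriplesY pY.1 pY.2).card) ≤
      Real.logb 2 (D.𝒯α.card) +
        (∑ s, ((termFibre (coarseYTermMap (isLevelTriple_of_mem_tripleSet (hD.subset hT₀))) s).card : ℝ) *
          shannonEntropy (fun σ => (kY s σ : ℝ) / (termFibre (coarseYTermMap (isLevelTriple_of_mem_tripleSet (hD.subset hT₀))) s).card)) -
        (n : ℝ) * shannonEntropy (fun a => (letterCount (pairSeq pY.1 pY.2) a : ℝ) / n) +
        Fintype.card (Fin (2 * c + 1) × (Fin c → Fin 3)) * Real.logb 2 ((n : ℝ) + 1) := by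
  have hμ : ∀ T ∈ D.𝒯α, letterCount T.2.1 = D.μY := fun T hT => (mem_typedSupport.1 (hD.subset hT)).2.1
  have hcount := advxxz2025_claim517_count hS hμ hT₀ hpY
  set V := (D.compatTriplesY pY.1 pY.2).card with hVdef
  set θ := letterCount (pairSeq pY.1 pY.2) with hθ
  have hθsum : ∑ a, θ a = n := sum_letterCount _
  rw [card_typeClass_eq_multinomial n θ hθsum] at hcount
  have hP : (0 : ℝ) < Nat.multinomial univ θ := by exact_mod_cast Nat.multinomial_pos _ _
  have hA : (0 : ℝ) < D.𝒯α.card := by exact_mod_cast card_pos.2 ⟨T₀, hT₀⟩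
  have hVr : (0 : ℝ) < V := by exact_mod_cast hV
  have hC : (0 : ℝ) < D.compatCountY T₀ := by
    have : (V : ℝ) * Nat.multinomial univ θ = D.𝒯α.card * D.compatCountY T₀ := by exact_mod_cast hcount
    by_contra hle
    rw [not_lt] at hle
    have hC0 : (D.compatCountY T₀ : ℝ) = 0 := le_antisymm hle (Nat.cast_nonneg _)
    rw [hC0, mul_zero] at this
    exact (mul_pos hVr hP).ne' this
  have hreal : (V : ℝ) = D.𝒯α.card * D.compatCountY T₀ / Nat.multinomial univ θ := by
    rw [eq_div_iff hP.ne']; exact_mod_cast hcount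
  have hCle := compatCountY_le_two_rpow hD hT₀ kY hk hsupp hsum
  have hPge := two_rpow_mul_shannonEntropy_le_mul_multinomial θ hθsum
  have hn1 : (0 : ℝ) < (n : ℝ) + 1 := by positivity
  rw [hreal, Real.logb_div (by positivity) hP.ne', Real.logb_mul hA.ne' hC.ne']
  have h1 := Real.logb_le_logb_of_le (b := 2) one_lt_two hC hCle
  rw [Real.logb_rpow two_pos (by norm_num)] at h1
  have h2 := Real.logb_le_logb_of_le (b := 2) one_lt_two (Real.rpow_pos_of_pos two_pos _) hPge
  rw [Real.logb_rpow two_pos (by norm_num), Real.logb_mul (pow_pos hn1 _).ne' hP.ne', Real.logb_pow] at h2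
  linarith

/-- **ADVXXZ Prop. 5.1, one region: the exponent, with explicit lower-order terms.**  Data: well-formed
(`MoreAsym.WellFormed`) symmetric `D` (`c, n ≥ 1`) whose `𝒯α` is the set of triples of joint type `Q`
(`∑ Q = n`, marginal types `μ_X, μ_Y, μ_Z` of `Q`), a triple `T₀ ∈ 𝒯α`, a typical `Y`-pair `pY = (J, Ĵ)` with
joint type `θ_Y` and a typical `Z`-pair `pZ = (K, K̂)` with joint type `θ_Z`, and integral class types
`k^Y_S` of the Claim-5.18 classes of `T₀` (`Λ_Y = ∑_S |S| H(k^Y_S/|S|) = n η_Y`) and `k^Z_S` of the VXXZ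
Def-5.15 classes of `T₀` (`Λ_Z = n λ_Z`).  With the parameters of `advxxz2025_prop51_region_parameters`
(`M₀ < M ≤ 2M₀`, `B` Behrend) and any `r ≥ 8^{3⌊log_{2N} 3^N⌋+3}`, the power `(CW_q^{⊗c})^{⊗n}` restricts to
`⟨κ⟩ ⊗ 𝒯*_{T₀}`, `κ = ⌊|B||𝒯α|/(2M²r)⌋`, and
`log₂(κ+1) ≥ n · min{H(μ_X/n) − P, H(θ_Y/n) − Λ_Y/n, H(θ_Z/n) − Λ_Z/n, H(Q/n)} − Err`,
`P = maxEnt_{levelSupport}(Q/n) − H(Q/n)`,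
`Err = (2|S₃| + (2c+1) + |A_pair|) log₂(n+1) + log₂(160cn) + log₂(2c+2) + log₂ r + 4√(log 2M₀)/log 2 + 7`
— the printed `2^{A₁n · min{H(α_X) − P_α, H(β̄_Y) − η_Y, H(β̄_Z) − λ_Z} − o(n)}` at the type `Q/n`.
[cite: AlmanDuanVassilevskaWilliamsXuXuZhou2025, Prop. 5.1 and §5.6 (Summary)] -/
theorem advxxz2025_prop51_region_logb {M₁ : ℕ} (D : GlobalStageData c n M₁) (hD : MoreAsym.WellFormed D)
    (hS : D.Symmetric) (R : Type u) [CommSemiring R] (q : ℕ) (hc : 0 < c) (hn : 0 < n)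
    {T₀ : (Fin n → Fin (2 * c + 1)) × (Fin n → Fin (2 * c + 1)) × (Fin n → Fin (2 * c + 1))} (hT₀ : T₀ ∈ D.𝒯α)
    {pY : (Fin n → Fin (2 * c + 1)) × (Fin n → Fin c → Fin 3)} (hpY : pY ∈ D.typicalPairsY)
    {pZ : (Fin n → Fin (2 * c + 1)) × (Fin n → Fin c → Fin 3)} (hpZ : pZ ∈ D.typicalPairs)
    {Q : Fin (2 * c + 1) × Fin (2 * c + 1) × Fin (2 * c + 1) → ℕ} (h𝒯α : D.𝒯α = jointTypeClass n Q)
    (hQ : ∑ s, Q s = n) (hμX : D.μX = fun i => ∑ j, ∑ l, Q (i, j, l))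
    (hμY : D.μY = fun j => ∑ i, ∑ l, Q (i, j, l)) (hμZ : D.μZ = fun l => ∑ i, ∑ j, Q (i, j, l))
    (kY : Fin (coarseYClasses c).card → (Fin c → Fin 3) → ℕ)
    (hkY : ∀ s σ, (kY s σ : ℝ) = (termFibre (coarseYTermMap (isLevelTriple_of_mem_tripleSet (hD.subset hT₀))) s).card *
      (coarseYTermList c D.α D.γY s).γX σ)
    (hsuppY : ∀ s σ, kY s σ ≠ 0 → patternLevel σ = (coarseYTermList c D.α D.γY s).i)
    (hsumY : ∀ s, ∑ σ, kY s σ = (termFibre (coarseYTermMap (isLevelTriple_of_mem_tripleSet (hD.subset hT₀))) s).card)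
    (kZ : Fin (coarseClasses c).card → (Fin c → Fin 3) → ℕ)
    (hkZ : ∀ s σ, (kZ s σ : ℝ) = (termFibre (coarseTermMap (isLevelTriple_of_mem_tripleSet (hD.subset hT₀))) s).card *
      (coarseTermList c D.α D.γZ s).γX σ)
    (hsuppZ : ∀ s σ, kZ s σ ≠ 0 → patternLevel σ = (coarseTermList c D.α D.γZ s).i)
    (hsumZ : ∀ s, ∑ σ, kZ s σ = (termFibre (coarseTermMap (isLevelTriple_of_mem_tripleSet (hD.subset hT₀))) s).card) :
    ∃ (M : ℕ) (B : Finset (ZMod M)), M.Prime ∧ MoreAsym.modulusBound D pY pZ < M ∧ M ≤ 2 * MoreAsym.modulusBound D pY pZ ∧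
      ThreeAPFree (B : Set (ZMod M)) ∧ (M : ℝ) / 2 * Real.exp (-4 * Real.sqrt (Real.log M)) ≤ B.card ∧
      ∀ {r : ℕ}, 8 ^ (3 * Nat.log (2 * (c * n)) (3 ^ (c * n)) + 3) ≤ r →
        TensorRestrictsTo (kroneckerPow (kroneckerPow (bigCwTensor R q) c) n)
          (kroneckerTensor (unitTensor R (B.card * D.𝒯α.card / (2 * M ^ 2 * r))) (D.starTensor R q T₀)) ∧
        (n : ℝ) * min (min (shannonEntropy (fun i => (D.μX i : ℝ) / n) -
              (maxEntropyGivenMarginals (levelSupport (2 * c)) (fun s => (Q s : ℝ) / n) - shannonEntropy (fun s => (Q s : ℝ) / n)))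
            (shannonEntropy (fun a => (letterCount (pairSeq pY.1 pY.2) a : ℝ) / n) -
              (∑ s, ((termFibre (coarseYTermMap (isLevelTriple_of_mem_tripleSet (hD.subset hT₀))) s).card : ℝ) *
                shannonEntropy (fun σ => (kY s σ : ℝ) /
                  (termFibre (coarseYTermMap (isLevelTriple_of_mem_tripleSet (hD.subset hT₀))) s).card)) / n))
          (min (shannonEntropy (fun a => (letterCount (pairSeq pZ.1 pZ.2) a : ℝ) / n) -
              (∑ s, ((termFibre (coarseTermMap (isLevelTriple_of_mem_tripleSet (hD.subset hT₀))) s).card : ℝ) *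
                shannonEntropy (fun σ => (kZ s σ : ℝ) /
                  (termFibre (coarseTermMap (isLevelTriple_of_mem_tripleSet (hD.subset hT₀))) s).card)) / n)
            (shannonEntropy (fun s => (Q s : ℝ) / n))) -
          ((2 * Fintype.card (Fin (2 * c + 1) × Fin (2 * c + 1) × Fin (2 * c + 1)) + (2 * c + 1) +
              Fintype.card (Fin (2 * c + 1) × (Fin c → Fin 3))) * Real.logb 2 ((n : ℝ) + 1) +
            Real.logb 2 (160 * (c * n)) + Real.logb 2 (2 * c + 2) + Real.logb 2 r +
            4 * Real.sqrt (Real.log (2 * MoreAsym.modulusBound D pY pZ)) / Real.log 2 + 7) ≤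
        Real.logb 2 ((B.card * D.𝒯α.card / (2 * M ^ 2 * r) : ℕ) + 1 : ℝ) := by
  have hD₀ : D.WellFormed := hD.toWellFormed
  obtain ⟨M, B, hMp, hM₀M, hM2, hBfree, hBcard, hres⟩ :=
    MoreAsym.advxxz2025_prop51_region_parameters D hD hS R q hc hn hT₀ hpY hpZ
  refine ⟨M, B, hMp, hM₀M, hM2, hBfree, hBcard, fun {r} hr => ⟨hres hr, ?_⟩⟩
  -- positivity facts
  have hT₀𝒯 : T₀ ∈ D.tripleSet := hD.subset hT₀
  have hApos : 0 < D.𝒯α.card := card_pos.2 ⟨T₀, hT₀⟩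
  have hTtpos : 0 < D.tripleSet.card := card_pos.2 ⟨T₀, hT₀𝒯⟩
  have hXpos : 0 < (typeClass n D.μX).card := card_pos.2 ⟨T₀.1, mem_typeClass.2 (mem_typedSupport.1 hT₀𝒯).1⟩
  have hM₀pos : 0 < MoreAsym.modulusBound D pY pZ := by
    have : 2 * c + 2 ≤ MoreAsym.modulusBound D pY pZ := le_max_of_le_right (le_max_right _ _)
    omega
  have hrpos : 0 < r := lt_of_lt_of_le (pow_pos (by norm_num) _) hr
  have hℓ0 : 0 ≤ Real.logb 2 ((n : ℝ) + 1) :=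
    Real.logb_nonneg one_lt_two (by have := Nat.cast_nonneg (α := ℝ) n; linarith)
  have hnr : (0 : ℝ) < n := by exact_mod_cast hn
  have hM₀r : (0 : ℝ) < MoreAsym.modulusBound D pY pZ := by exact_mod_cast hM₀pos
  have hcn : (0 : ℝ) < 160 * ((c : ℝ) * n) := by
    have : (0:ℝ) < c := by exact_mod_cast hc
    positivity
  have hlog160 : 0 ≤ Real.logb 2 (160 * ((c : ℝ) * n)) := by
    refine Real.logb_nonneg one_lt_two ?_
    have : (1:ℝ) ≤ c := by exact_mod_cast hc
    have : (1:ℝ) ≤ n := by exact_mod_cast hn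
    nlinarith
  have hlog2c : 0 ≤ Real.logb 2 (2 * (c : ℝ) + 2) :=
    Real.logb_nonneg one_lt_two (by have := Nat.cast_nonneg (α := ℝ) c; linarith)
  have hμXsum : ∑ i, D.μX i = n := by
    rw [← (mem_typedSupport.1 hT₀𝒯).1]; exact sum_letterCount _
  have hFin : (Fintype.card (Fin (2 * c + 1)) : ℝ) = 2 * c + 1 := by simp
  -- the pieces
  have eA := logb_card_alphaTriples_ge (D := D) h𝒯α hQ
  have eT := logb_card_tripleSet_le (D := D) hn hμX hμY hμZ
  have eX := logb_card_typeClass_ge D.μX hμXsum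
  rw [hFin] at eX
  have e0 := logb_copies_ge (A := D.𝒯α.card) (Bc := B.card) hM₀pos hM₀M hM2 hrpos hBcard hApos
  -- the four branches of `M₀`
  have hM₀le := MoreAsym.modulusBound_le (D := D) pY pZ hXpos
  have h16 : Real.logb 2 (16 : ℝ) = 4 := by
    rw [show (16:ℝ) = 2 ^ (4:ℕ) by norm_num, Real.logb_pow, Real.logb_self_eq_one one_lt_two]; norm_num
  have hbranch : Real.logb 2 (MoreAsym.modulusBound D pY pZ) ≤ 4 + Real.logb 2 (D.tripleSet.card) - Real.logb 2 ((typeClass n D.μX).card) ∨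
      (Real.logb 2 (MoreAsym.modulusBound D pY pZ) ≤ Real.logb 2 (160 * ((c : ℝ) * n)) + Real.logb 2 ((D.compatTriplesY pY.1 pY.2).card) ∧
        Real.logb 2 ((D.compatTriplesY pY.1 pY.2).card) ≤ Real.logb 2 (D.𝒯α.card) +
          (∑ s, ((termFibre (coarseYTermMap (isLevelTriple_of_mem_tripleSet (hD.subset hT₀))) s).card : ℝ) *
            shannonEntropy (fun σ => (kY s σ : ℝ) /
              (termFibre (coarseYTermMap (isLevelTriple_of_mem_tripleSet (hD.subset hT₀))) s).card)) -
          (n : ℝ) * shannonEntropy (fun a => (letterCount (pairSeq pY.1 pY.2) a : ℝ) / n) +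
          Fintype.card (Fin (2 * c + 1) × (Fin c → Fin 3)) * Real.logb 2 ((n : ℝ) + 1)) ∨
      (Real.logb 2 (MoreAsym.modulusBound D pY pZ) ≤ Real.logb 2 (160 * ((c : ℝ) * n)) + Real.logb 2 ((D.compatTriples pZ.1 pZ.2).card) ∧
        Real.logb 2 ((D.compatTriples pZ.1 pZ.2).card) ≤ Real.logb 2 (D.𝒯α.card) +
          (∑ s, ((termFibre (coarseTermMap (isLevelTriple_of_mem_tripleSet (hD.subset hT₀))) s).card : ℝ) *
            shannonEntropy (fun σ => (kZ s σ : ℝ) /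
              (termFibre (coarseTermMap (isLevelTriple_of_mem_tripleSet (hD.subset hT₀))) s).card)) -
          (n : ℝ) * shannonEntropy (fun a => (letterCount (pairSeq pZ.1 pZ.2) a : ℝ) / n) +
          Fintype.card (Fin (2 * c + 1) × (Fin c → Fin 3)) * Real.logb 2 ((n : ℝ) + 1)) ∨
      Real.logb 2 (MoreAsym.modulusBound D pY pZ) ≤ Real.logb 2 (2 * (c : ℝ) + 2) := by
    rcases le_max_iff.1 hM₀le with h12 | h34
    · rcases le_max_iff.1 h12 with h1 | h2
      · left
        have hl := Real.logb_le_logb_of_le one_lt_two hM₀r h1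
        rw [Real.logb_div (by positivity) (by exact_mod_cast hXpos.ne'),
          Real.logb_mul (by norm_num) (by exact_mod_cast hTtpos.ne'), h16] at hl
        exact hl
      · right; left
        have hVpos : 0 < (D.compatTriplesY pY.1 pY.2).card := by
          by_contra hV0
          rw [not_lt, Nat.le_zero] at hV0
          rw [hV0] at h2; simp at h2; linarith
        have hl := Real.logb_le_logb_of_le one_lt_two hM₀r h2
        rw [Real.logb_mul hcn.ne' (by exact_mod_cast hVpos.ne')] at hl
        exact ⟨hl, logb_card_compatTriplesY_le hD₀ hS hT₀ hpY kY hkY hsuppY hsumY hVpos⟩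
    · rcases le_max_iff.1 h34 with h3 | h4
      · right; right; left
        have hVpos : 0 < (D.compatTriples pZ.1 pZ.2).card := by
          by_contra hV0
          rw [not_lt, Nat.le_zero] at hV0
          rw [hV0] at h3; simp at h3; linarith
        have hl := Real.logb_le_logb_of_le one_lt_two hM₀r h3
        rw [Real.logb_mul hcn.ne' (by exact_mod_cast hVpos.ne')] at hl
        exact ⟨hl, logb_card_compatTriples_le hD₀ hS hT₀ hpZ kZ hkZ hsuppZ hsumZ hVpos⟩
      · right; right; right
        exact Real.logb_le_logb_of_le one_lt_two hM₀r h4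
  have key := exponent_combine₃ (lM₀ := Real.logb 2 (MoreAsym.modulusBound D pY pZ)) hnr hℓ0 (Nat.cast_nonneg _)
    (Nat.cast_nonneg _) (by positivity : (0:ℝ) ≤ 2 * (c : ℝ) + 1) hlog160 hlog2c eA eT eX hbranch
  linarith [key, e0]

end GlobalStageData

end Literature.Computability.AlgebraicComplexity
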